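import Literature.NumberTheory.Transcendental.TubbsPeriodsFunction
import HarnessLib

/-!
# Tubbs 1990, Theorem 4 (periods form) — the analytic half (Schwarz's lemma for `σ^{2L}F`)

Topic `Literature/NumberTheory/Transcendental` (trunk T-TRANSCEND). Third file of the discharge of
`Literature.NumberTheory.Transcendental.Tubbs1990_thm4_periods` (Tubbs 1990, Thm 4 = Chudnovsky
1984, Ch. 7, Thm 4.1 (i)); the analogue of `ChudnovskyAnalytic.lean`, Part I, for the auxiliary
function `F_p(z) = ∑ p(i,j,k) (z - ω₁/2)ⁱ e^{jc(z - ω₁/2)} (℘(z) - e₁)ᵏ` of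
`TubbsPeriodsFunction.lean`.

Chudnovsky 1984, Ch. 7, p. 306 and p. 310: "we use Schwarz' lemma applied to the function
`σ(z)^{3L} F(z)`". Here `σ(z)^{2(L₁-1)} F_p(z)` is the entire function
`G_p = ∑ p(i,j,k) (z-ω₁/2)ⁱ e^{jc(z-ω₁/2)} (σ²℘ - e₁σ²)ᵏ σ^{2(L₁-1-k)}` (`σ²℘ = σ'² - σσ''`,
tree `Chudnovsky.Sp`). If `F_p` vanishes to order `≥ T'` at the `X²` points
`z_n = ω₁/2 + n₁ω₁ + n₂ω₂`, `0 ≤ n₁, n₂ < X`, then so does `G_p`, and Schwarz's lemma on the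
disc of radius `5r`, `r = (2r₁ + 1)X` (`r₁ = ‖ω₁‖ + ‖ω₂‖ + 1`), bounds `G_p` on `|w| ≤ r` by its
maximum on `|z| = 5r` times `2^{-T'X²}`; dividing by `σ^{2(L₁-1)}` on small circles around
the points `z_n` with `n₁, n₂ < 2X` (where `|σ| ≥ c₀ e^{-C₁X²}`) and Cauchy's inequality give
**the fundamental upper bound for the derivatives `F_p^{(t)}(z_n)`, `n₁, n₂ < 2X`** — the form
in which the estimate is iterated ("extrapolation") in `TubbsPeriodsConstruction.lean`.

## Contents

* `G`, `G_eq`, `differentiable_G`, `norm_G_le` — the entire function and its growth;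
* `r₁`, `box`, `pts`, `card_pts`, `norm_zpt_le` — the points `z_n`, `n ∈ [0,X)²`;
* `le_analyticOrderAt_G` — vanishing of derivatives of `F_p` gives the order of `G_p`;
* `norm_G_le_of_zeros` — Schwarz's lemma;
* `le_norm_weierstrassSigma_add_lvec` — `|σ(k + n₁ω₁ + n₂ω₂)| ≥ c₀ e^{-C₁X²}`, `nᵢ < 2X`;
* `norm_iteratedDeriv_F_zpt_le_of_zeros` — the fundamental upper bound.

## References

* G. V. Chudnovsky, *Contributions to the theory of transcendental numbers* (1984), Ch. 7 §2
  p. 306, §3 p. 310, Thm 4.1 (i) p. 318. [Chudnovsky1984]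
* R. Tubbs, J. Number Theory 35 (1990), Thm 4 (p. 112), §5. [Tubbs1990]
-/

noncomputable section

open Complex Metric Filter Topology Finset
open scoped PeriodPair Nat

namespace Literature.NumberTheory.Transcendental.TubbsPeriods

open Literature.NumberTheory.Transcendental.Chudnovsky (e₁ add_notMem Sp sigma_sq_mul_weierstrassP
  differentiable_Sp exists_bound_Sg_Sp_sigma exists_closedBall_subset_compl_lattice)

variable (L : PeriodPair) (c : ℂ) {La L0 L1 : ℕ}

/-! ### The entire function `G_p = σ^{2(L₁-1)} F_p` -/

/-- The entire function
`G_p = ∑ p(i,j,k) (z-ω₁/2)ⁱ e^{jc(z-ω₁/2)} (σ²℘ - e₁σ²)ᵏ σ^{2(L₁-1-k)}`, equal to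
`σ^{2(L₁-1)} F_p` off the lattice. [cite: Chudnovsky1984, Ch. 7 §3 p. 310] -/
def G (p : Lam La L0 L1 → ℂ) (z : ℂ) : ℂ :=
  ∑ l, p l * ((z - L.ω₁ / 2) ^ (l.1 : ℕ) * cexp ((l.2.1 : ℕ) * c * (z - L.ω₁ / 2)) *
    (Sp L z - e₁ L * L.weierstrassSigma z ^ 2) ^ (l.2.2 : ℕ) *
      L.weierstrassSigma z ^ (2 * (L1 - 1 - l.2.2)))

/-- `σ²(℘ - e₁) = Sp - e₁σ²` off the lattice. [folklore] -/
lemma sigma_sq_mul_sub {z : ℂ} (hz : z ∉ L.lattice) :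
    L.weierstrassSigma z ^ 2 * (℘[L] z - e₁ L) = Sp L z - e₁ L * L.weierstrassSigma z ^ 2 := by
  rw [mul_sub, sigma_sq_mul_weierstrassP L hz]; ring

/-- `G_p = σ^{2(L₁-1)} F_p` off the lattice. [folklore] -/
theorem G_eq {z : ℂ} (hz : z ∉ L.lattice) (p : Lam La L0 L1 → ℂ) :
    G L c p z = L.weierstrassSigma z ^ (2 * (L1 - 1)) * F L c p z := by
  unfold G F
  rw [Finset.mul_sum]
  refine Finset.sum_congr rfl fun l _ => ?_
  rw [← sigma_sq_mul_sub L hz]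
  have h2 : (l.2.2 : ℕ) + 1 ≤ L1 := l.2.2.isLt
  have hD : 2 * (L1 - 1) = 2 * (L1 - 1 - l.2.2) + 2 * (l.2.2 : ℕ) := by omega
  rw [hD, pow_add, mul_pow, ← pow_mul]
  ring

/-- `G_p` and `σ^{2(L₁-1)} F_p` agree near every non-lattice point. [folklore] -/
theorem G_eventuallyEq {z : ℂ} (hz : z ∉ L.lattice) (p : Lam La L0 L1 → ℂ) :
    G L c p =ᶠ[𝓝 z] (fun w => L.weierstrassSigma w ^ (2 * (L1 - 1))) * F L c p := by
  filter_upwards [L.isClosed_lattice.isOpen_compl.mem_nhds hz] with w hw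
  exact G_eq L c hw p

/-- `G_p` is entire. [folklore] -/
theorem differentiable_G (p : Lam La L0 L1 → ℂ) : Differentiable ℂ (G L c p) := by
  have hσ : Differentiable ℂ L.weierstrassSigma := L.differentiable_weierstrassSigma_holds
  have h2 := differentiable_Sp L
  unfold G
  fun_prop

/-- The terms of `p` are bounded by `‖p‖` (sup norm). [folklore] -/
lemma norm_apply_le (p : Lam La L0 L1 → ℂ) (l : Lam La L0 L1) : ‖p l‖ ≤ ‖p‖ :=
  norm_le_pi_norm p l

/-- **Growth of `G_p`.** There is `C ≥ 0` depending only on the lattice such that for `R ≥ 1`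
and `|z| ≤ R`,
`‖G_p(z)‖ ≤ ‖p‖ · #Λ · (R + ‖ω₁‖)^{La} · exp(L0 ‖c‖ (R + ‖ω₁‖)) · exp(C L1 (1 + R²))`.
[cite: Chudnovsky1984, Ch. 7 §3 p. 310] -/
theorem norm_G_le :
    ∃ C : ℝ, 0 ≤ C ∧ ∀ (La L0 L1 : ℕ) (p : Lam La L0 L1 → ℂ) (R : ℝ), 1 ≤ R → ∀ z : ℂ, ‖z‖ ≤ R →
      ‖G L c p z‖ ≤ ‖p‖ * Fintype.card (Lam La L0 L1) * (R + ‖L.ω₁‖) ^ La *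
        Real.exp (L0 * ‖c‖ * (R + ‖L.ω₁‖)) * Real.exp (C * L1 * (1 + R ^ 2)) := by
  obtain ⟨C, hC, h⟩ := exists_bound_Sg_Sp_sigma L
  refine ⟨2 * C + ‖e₁ L‖, by positivity, fun La L0 L1 p R hR z hz => ?_⟩
  obtain ⟨-, hSp, hσ⟩ := h z
  set t : ℝ := 1 + ‖z‖ ^ 2 with ht
  set tR : ℝ := 1 + R ^ 2 with htR
  have htt : t ≤ tR := by rw [ht, htR]; nlinarith [norm_nonneg z]
  have ht1 : 1 ≤ t := by nlinarith [norm_nonneg z]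
  set E : ℝ := Real.exp (C * tR) with hE
  have hE1 : 1 ≤ E := Real.one_le_exp (by positivity)
  have hσE : ‖L.weierstrassSigma z‖ ≤ E := hσ.trans (Real.exp_le_exp.mpr (by nlinarith))
  have hSpE : ‖Sp L z‖ ≤ E := hSp.trans (Real.exp_le_exp.mpr (by nlinarith))
  -- the base `Sp - e₁σ²`
  have hbase : ‖Sp L z - e₁ L * L.weierstrassSigma z ^ 2‖ ≤ (1 + ‖e₁ L‖) * E ^ 2 := by
    calc ‖Sp L z - e₁ L * L.weierstrassSigma z ^ 2‖
        ≤ ‖Sp L z‖ + ‖e₁ L * L.weierstrassSigma z ^ 2‖ := norm_sub_le _ _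
      _ = ‖Sp L z‖ + ‖e₁ L‖ * ‖L.weierstrassSigma z‖ ^ 2 := by rw [norm_mul, norm_pow]
      _ ≤ E + ‖e₁ L‖ * E ^ 2 := by gcongr
      _ ≤ E ^ 2 + ‖e₁ L‖ * E ^ 2 := by nlinarith
      _ = (1 + ‖e₁ L‖) * E ^ 2 := by ring
  have hzω : ‖z - L.ω₁ / 2‖ ≤ R + ‖L.ω₁‖ := by
    calc ‖z - L.ω₁ / 2‖ ≤ ‖z‖ + ‖L.ω₁ / 2‖ := norm_sub_le _ _
      _ ≤ R + ‖L.ω₁‖ := by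
          gcongr
          rw [norm_div, Complex.norm_two]
          linarith [norm_nonneg L.ω₁]
  have hRω : 1 ≤ R + ‖L.ω₁‖ := by linarith [norm_nonneg L.ω₁]
  -- each term
  have hterm : ∀ l : Lam La L0 L1,
      ‖p l * ((z - L.ω₁ / 2) ^ (l.1 : ℕ) * cexp ((l.2.1 : ℕ) * c * (z - L.ω₁ / 2)) *
        (Sp L z - e₁ L * L.weierstrassSigma z ^ 2) ^ (l.2.2 : ℕ) *
          L.weierstrassSigma z ^ (2 * (L1 - 1 - l.2.2)))‖ ≤
        ‖p‖ * ((R + ‖L.ω₁‖) ^ La * Real.exp (L0 * ‖c‖ * (R + ‖L.ω₁‖)) *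
          ((1 + ‖e₁ L‖) ^ L1 * E ^ (2 * L1))) := by
    intro l
    have hi : (l.1 : ℕ) ≤ La := l.1.isLt.le
    have hj : (l.2.1 : ℕ) ≤ L0 := l.2.1.isLt.le
    have hk : (l.2.2 : ℕ) + 1 ≤ L1 := l.2.2.isLt
    rw [norm_mul]
    refine mul_le_mul (norm_apply_le p l) ?_ (norm_nonneg _) (norm_nonneg _)
    rw [norm_mul, norm_mul, norm_mul]
    have h1 : ‖(z - L.ω₁ / 2) ^ (l.1 : ℕ)‖ ≤ (R + ‖L.ω₁‖) ^ La := by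
      rw [norm_pow]
      exact (pow_le_pow_left₀ (norm_nonneg _) hzω _).trans (pow_le_pow_right₀ hRω hi)
    have h2 : ‖cexp ((l.2.1 : ℕ) * c * (z - L.ω₁ / 2))‖ ≤ Real.exp (L0 * ‖c‖ * (R + ‖L.ω₁‖)) := by
      rw [Complex.norm_exp]
      refine Real.exp_le_exp.mpr ((Complex.re_le_norm _).trans ?_)
      rw [norm_mul, norm_mul, Complex.norm_natCast]
      have : ((l.2.1 : ℕ) : ℝ) ≤ L0 := by exact_mod_cast hj
      have h0 : 0 ≤ ‖c‖ * ‖z - L.ω₁ / 2‖ := by positivity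
      calc ((l.2.1 : ℕ) : ℝ) * ‖c‖ * ‖z - L.ω₁ / 2‖ ≤ L0 * ‖c‖ * ‖z - L.ω₁ / 2‖ := by
            nlinarith
        _ ≤ L0 * ‖c‖ * (R + ‖L.ω₁‖) := by gcongr
    have h3 : ‖(Sp L z - e₁ L * L.weierstrassSigma z ^ 2) ^ (l.2.2 : ℕ)‖ *
        ‖L.weierstrassSigma z ^ (2 * (L1 - 1 - l.2.2))‖ ≤ (1 + ‖e₁ L‖) ^ L1 * E ^ (2 * L1) := by
      rw [norm_pow, norm_pow]
      have he1 : 1 ≤ 1 + ‖e₁ L‖ := by linarith [norm_nonneg (e₁ L)]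
      calc ‖Sp L z - e₁ L * L.weierstrassSigma z ^ 2‖ ^ (l.2.2 : ℕ) *
            ‖L.weierstrassSigma z‖ ^ (2 * (L1 - 1 - l.2.2))
          ≤ ((1 + ‖e₁ L‖) * E ^ 2) ^ (l.2.2 : ℕ) * E ^ (2 * (L1 - 1 - l.2.2)) := by gcongr
        _ = (1 + ‖e₁ L‖) ^ (l.2.2 : ℕ) * E ^ (2 * (l.2.2 : ℕ) + 2 * (L1 - 1 - l.2.2)) := by
            rw [mul_pow, ← pow_mul, pow_add]; ring
        _ ≤ (1 + ‖e₁ L‖) ^ L1 * E ^ (2 * L1) :=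
            mul_le_mul (pow_le_pow_right₀ he1 (by omega)) (pow_le_pow_right₀ hE1 (by omega))
              (by positivity) (by positivity)
    calc ‖(z - L.ω₁ / 2) ^ (l.1 : ℕ)‖ * ‖cexp ((l.2.1 : ℕ) * c * (z - L.ω₁ / 2))‖ *
          ‖(Sp L z - e₁ L * L.weierstrassSigma z ^ 2) ^ (l.2.2 : ℕ)‖ *
            ‖L.weierstrassSigma z ^ (2 * (L1 - 1 - l.2.2))‖
        = (‖(z - L.ω₁ / 2) ^ (l.1 : ℕ)‖ * ‖cexp ((l.2.1 : ℕ) * c * (z - L.ω₁ / 2))‖) *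
          (‖(Sp L z - e₁ L * L.weierstrassSigma z ^ 2) ^ (l.2.2 : ℕ)‖ *
            ‖L.weierstrassSigma z ^ (2 * (L1 - 1 - l.2.2))‖) := by ring
      _ ≤ ((R + ‖L.ω₁‖) ^ La * Real.exp (L0 * ‖c‖ * (R + ‖L.ω₁‖))) *
          ((1 + ‖e₁ L‖) ^ L1 * E ^ (2 * L1)) := by
          refine mul_le_mul (mul_le_mul h1 h2 (norm_nonneg _) (by positivity)) h3
            (by positivity) (by positivity)
  -- the constant: `(1 + ‖e₁‖)^L1 E^{2 L1} ≤ exp((2C + ‖e₁‖) L1 (1+R²))`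
  have hconst : (1 + ‖e₁ L‖) ^ L1 * E ^ (2 * L1) ≤ Real.exp ((2 * C + ‖e₁ L‖) * L1 * (1 + R ^ 2)) := by
    have h1 : (1 + ‖e₁ L‖) ^ L1 ≤ Real.exp (‖e₁ L‖ * L1 * tR) := by
      calc (1 + ‖e₁ L‖) ^ L1 ≤ Real.exp ‖e₁ L‖ ^ L1 := by
            refine pow_le_pow_left₀ (by positivity) ?_ _
            have := Real.add_one_le_exp ‖e₁ L‖
            linarith
        _ = Real.exp (‖e₁ L‖ * L1) := by rw [← Real.exp_nat_mul]; ring_nf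
        _ ≤ Real.exp (‖e₁ L‖ * L1 * tR) := by
            refine Real.exp_le_exp.mpr ?_
            have h0 : 0 ≤ ‖e₁ L‖ * L1 := by positivity
            have htR1 : 1 ≤ tR := by rw [htR]; nlinarith
            nlinarith
    have h2 : E ^ (2 * L1) = Real.exp (2 * C * L1 * tR) := by
      rw [hE, ← Real.exp_nat_mul]; push_cast; ring_nf
    rw [h2, ← htR]
    calc (1 + ‖e₁ L‖) ^ L1 * Real.exp (2 * C * L1 * tR)
        ≤ Real.exp (‖e₁ L‖ * L1 * tR) * Real.exp (2 * C * L1 * tR) := by gcongr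
      _ = Real.exp ((2 * C + ‖e₁ L‖) * L1 * tR) := by rw [← Real.exp_add]; ring_nf
  calc ‖G L c p z‖ ≤ ∑ l, ‖p l * ((z - L.ω₁ / 2) ^ (l.1 : ℕ) * cexp ((l.2.1 : ℕ) * c * (z - L.ω₁ / 2)) *
        (Sp L z - e₁ L * L.weierstrassSigma z ^ 2) ^ (l.2.2 : ℕ) *
          L.weierstrassSigma z ^ (2 * (L1 - 1 - l.2.2)))‖ := norm_sum_le _ _
    _ ≤ ∑ _l : Lam La L0 L1, ‖p‖ * ((R + ‖L.ω₁‖) ^ La * Real.exp (L0 * ‖c‖ * (R + ‖L.ω₁‖)) *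
          ((1 + ‖e₁ L‖) ^ L1 * E ^ (2 * L1))) := Finset.sum_le_sum fun l _ => hterm l
    _ = Fintype.card (Lam La L0 L1) * (‖p‖ * ((R + ‖L.ω₁‖) ^ La *
          Real.exp (L0 * ‖c‖ * (R + ‖L.ω₁‖)) * ((1 + ‖e₁ L‖) ^ L1 * E ^ (2 * L1)))) := by
        rw [Finset.sum_const, Finset.card_univ, nsmul_eq_mul]
    _ ≤ Fintype.card (Lam La L0 L1) * (‖p‖ * ((R + ‖L.ω₁‖) ^ La *
          Real.exp (L0 * ‖c‖ * (R + ‖L.ω₁‖)) * Real.exp ((2 * C + ‖e₁ L‖) * L1 * (1 + R ^ 2)))) := by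
        gcongr
    _ = _ := by ring

/-! ### The points `z_n`, `n ∈ [0, X)²` -/

/-- `r₁ = ‖ω₁‖ + ‖ω₂‖ + 1`: `‖z_n‖ ≤ r₁ X` for `n₁, n₂ < X`. [folklore] -/
def r₁ : ℝ := ‖L.ω₁‖ + ‖L.ω₂‖ + 1

/-- `1 ≤ r₁`. [folklore] -/
lemma one_le_r₁ : 1 ≤ r₁ L := by
  unfold r₁; nlinarith [norm_nonneg L.ω₁, norm_nonneg L.ω₂]

/-- `‖n₁ω₁ + n₂ω₂‖ ≤ (r₁ - 1) X` for `n₁, n₂ ≤ X`. [folklore] -/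
lemma norm_lvec_le {X : ℕ} {n : ℕ × ℕ} (h1 : n.1 ≤ X) (h2 : n.2 ≤ X) :
    ‖lvec L n‖ ≤ (‖L.ω₁‖ + ‖L.ω₂‖) * X := by
  have h1' : (n.1 : ℝ) ≤ X := by exact_mod_cast h1
  have h2' : (n.2 : ℝ) ≤ X := by exact_mod_cast h2
  unfold lvec
  calc ‖(n.1 : ℂ) * L.ω₁ + (n.2 : ℂ) * L.ω₂‖ ≤ ‖(n.1 : ℂ) * L.ω₁‖ + ‖(n.2 : ℂ) * L.ω₂‖ :=
        norm_add_le _ _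
    _ = n.1 * ‖L.ω₁‖ + n.2 * ‖L.ω₂‖ := by
        rw [norm_mul, norm_mul, Complex.norm_natCast, Complex.norm_natCast]
    _ ≤ X * ‖L.ω₁‖ + X * ‖L.ω₂‖ := by gcongr
    _ = (‖L.ω₁‖ + ‖L.ω₂‖) * X := by ring

/-- `‖z_n + u‖ ≤ r₁ X` for `n₁, n₂ < X` (`X ≥ 1`), `‖u‖ ≤ 1/2`. [folklore] -/
lemma norm_zpt_add_le {X : ℕ} (hX : 1 ≤ X) {n : ℕ × ℕ} (h1 : n.1 < X) (h2 : n.2 < X)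
    {u : ℂ} (hu : ‖u‖ ≤ 1 / 2) : ‖zpt L n + u‖ ≤ r₁ L * X := by
  have hX' : (1 : ℝ) ≤ X := by exact_mod_cast hX
  have hn1 : n.1 ≤ X - 1 := by omega
  have hn2 : n.2 ≤ X - 1 := by omega
  have hl := norm_lvec_le L hn1 hn2
  have hXm : ((X - 1 : ℕ) : ℝ) = X - 1 := by
    rw [Nat.cast_sub hX]; simp
  rw [hXm] at hl
  unfold zpt r₁
  calc ‖L.ω₁ / 2 + lvec L n + u‖ ≤ ‖L.ω₁ / 2‖ + ‖lvec L n‖ + ‖u‖ :=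
        (norm_add_le _ _).trans (add_le_add (norm_add_le _ _) le_rfl)
    _ ≤ ‖L.ω₁‖ / 2 + (‖L.ω₁‖ + ‖L.ω₂‖) * (X - 1) + 1 / 2 := by
        gcongr
        rw [norm_div, Complex.norm_two]
    _ ≤ (‖L.ω₁‖ + ‖L.ω₂‖ + 1) * X := by
        nlinarith [norm_nonneg L.ω₁, norm_nonneg L.ω₂]

/-- `‖z_n‖ ≤ r₁ X` for `n₁, n₂ < X` (`X ≥ 1`). [folklore] -/
lemma norm_zpt_le {X : ℕ} (hX : 1 ≤ X) {n : ℕ × ℕ} (h1 : n.1 < X) (h2 : n.2 < X) :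
    ‖zpt L n‖ ≤ r₁ L * X := by
  have := norm_zpt_add_le L hX h1 h2 (u := 0) (by simp)
  simpa using this

/-- The box `[0, X)² ⊂ ℕ²`. [folklore] -/
def box (X : ℕ) : Finset (ℕ × ℕ) := Finset.range X ×ˢ Finset.range X

/-- Membership in the box. [folklore] -/
@[simp] lemma mem_box {X : ℕ} {n : ℕ × ℕ} : n ∈ box X ↔ n.1 < X ∧ n.2 < X := by
  simp [box]

/-- `#box X = X²`. [folklore] -/
lemma card_box (X : ℕ) : (box X).card = X ^ 2 := by
  simp [box, sq]

/-- The map `n ↦ z_n` is injective (`ω₁, ω₂` are `ℝ`-linearly independent). [folklore] -/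
lemma zpt_injective : Function.Injective (zpt L) := by
  rintro ⟨a, b⟩ ⟨a', b'⟩ h
  simp only [zpt, lvec] at h
  have h' : ((a : ℝ) - a') • L.ω₁ + ((b : ℝ) - b') • L.ω₂ = 0 := by
    simp only [Complex.real_smul]
    push_cast
    linear_combination h
  obtain ⟨h1, h2⟩ := LinearIndependent.pair_iff.mp L.indep _ _ h'
  have ha : a = a' := by exact_mod_cast sub_eq_zero.mp h1
  have hb : b = b' := by exact_mod_cast sub_eq_zero.mp h2
  rw [ha, hb]

/-- `n ↦ n₁ω₁ + n₂ω₂` is injective. [folklore] -/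
lemma lvec_injective : Function.Injective (lvec L) := by
  intro n n' h
  exact zpt_injective L (by unfold zpt; rw [h])

/-- The points `z_n`, `n ∈ [0, X)²`, as a finite set of complex numbers. [folklore] -/
def pts (X : ℕ) : Finset ℂ := (box X).image (zpt L)

/-- `#pts X = X²`. [folklore] -/
lemma card_pts (X : ℕ) : (pts L X).card = X ^ 2 := by
  rw [pts, Finset.card_image_of_injective _ (zpt_injective L), card_box]

/-- Membership in `pts`. [folklore] -/
lemma mem_pts {X : ℕ} {x : ℂ} (hx : x ∈ pts L X) : ∃ n : ℕ × ℕ, n.1 < X ∧ n.2 < X ∧ x = zpt L n := by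
  rw [pts, Finset.mem_image] at hx
  obtain ⟨n, hn, rfl⟩ := hx
  rw [mem_box] at hn
  exact ⟨n, hn.1, hn.2, rfl⟩

/-! ### Zeros of high order at the points `z_n` -/

/-- If `F_p^{(t)}(z_n) = 0` for `t < T` then the entire function `G_p` vanishes to order `≥ T`
at `z_n`. [folklore] -/
theorem le_analyticOrderAt_G (p : Lam La L0 L1 → ℂ) {T : ℕ} {n : ℕ × ℕ}
    (h : ∀ t < T, iteratedDeriv t (F L c p) (zpt L n) = 0) :
    (T : ℕ∞) ≤ analyticOrderAt (G L c p) (zpt L n) := by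
  have hc : zpt L n ∉ L.lattice := zpt_notMem L n
  have h2 : (T : ℕ∞) ≤ analyticOrderAt (F L c p) (zpt L n) :=
    (natCast_le_analyticOrderAt_iff_iteratedDeriv_eq_zero (analyticAt_F L c p hc)).mpr h
  have hσ : AnalyticAt ℂ (fun w => L.weierstrassSigma w ^ (2 * (L1 - 1))) (zpt L n) :=
    ((show Differentiable ℂ L.weierstrassSigma from
      L.differentiable_weierstrassSigma_holds).analyticAt _).pow _
  rw [analyticOrderAt_congr (G_eventuallyEq L c hc p), analyticOrderAt_mul hσ (analyticAt_F L c p hc)]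
  exact le_add_left h2

/-! ### Schwarz's lemma for `G_p` -/

/-- The radius `r = (2r₁ + 1) X` of the disc containing the points `z_n`, `n₁, n₂ < 2X`, together
with the circles of radius `≤ 1/2` around them. [folklore] -/
def rad (X : ℕ) : ℝ := (2 * r₁ L + 1) * X

/-- `X ≤ rad X` and `1 ≤ rad X` for `X ≥ 1`. [folklore] -/
lemma one_le_rad {X : ℕ} (hX : 1 ≤ X) : 1 ≤ rad L X := by
  have hX' : (1 : ℝ) ≤ X := by exact_mod_cast hX
  unfold rad; nlinarith [one_le_r₁ L]

/-- The bound `Θ(X)` for `|G_p|` on the circle `|z| = 5 rad X` divided by `‖p‖`: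
`#Λ (5 rad X + ‖ω₁‖)^{La} exp(L0‖c‖(5 rad X + ‖ω₁‖)) exp(C L1 (1 + 25 rad X²))`. [folklore] -/
def ΘG (C : ℝ) (La L0 L1 X : ℕ) : ℝ :=
  Fintype.card (Lam La L0 L1) * (5 * rad L X + ‖L.ω₁‖) ^ La *
    Real.exp (L0 * ‖c‖ * (5 * rad L X + ‖L.ω₁‖)) * Real.exp (C * L1 * (1 + (5 * rad L X) ^ 2))

/-- `0 ≤ ΘG`. [folklore] -/
lemma ΘG_nonneg {C : ℝ} (La L0 L1 X : ℕ) : 0 ≤ ΘG L c C La L0 L1 X := by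
  unfold ΘG rad
  have := one_le_r₁ L
  positivity

/-- **Schwarz's lemma for `G_p`.** With the constant `C` of `norm_G_le`: if
`F_p^{(t)}(z_n) = 0` for all `t < T'` and all `n ∈ [0,X)²` (`X ≥ 1`), then for `|w| ≤ rad X`,
`‖G_p(w)‖ ≤ ‖p‖ ΘG(X) (1/2)^{T' X²}`: `G_p` has `X²` zeros of order `≥ T'` in `|z| ≤ rad X`, and
one compares with the circle `|z| = 5 rad X`. [cite: Chudnovsky1984, Ch. 7 §3 p. 310] -/
theorem norm_G_le_of_zeros {C : ℝ}
    (hG : ∀ (La L0 L1 : ℕ) (p : Lam La L0 L1 → ℂ) (R : ℝ), 1 ≤ R → ∀ z : ℂ, ‖z‖ ≤ R →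
      ‖G L c p z‖ ≤ ‖p‖ * Fintype.card (Lam La L0 L1) * (R + ‖L.ω₁‖) ^ La *
        Real.exp (L0 * ‖c‖ * (R + ‖L.ω₁‖)) * Real.exp (C * L1 * (1 + R ^ 2)))
    {X T' : ℕ} (hX : 1 ≤ X) (p : Lam La L0 L1 → ℂ)
    (hF : ∀ n : ℕ × ℕ, n.1 < X → n.2 < X → ∀ t < T', iteratedDeriv t (F L c p) (zpt L n) = 0)
    {w : ℂ} (hw : ‖w‖ ≤ rad L X) :
    ‖G L c p w‖ ≤ ‖p‖ * ΘG L c C La L0 L1 X * (1 / 2) ^ (T' * X ^ 2) := by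
  have hr := one_le_rad L hX
  have hr0 : 0 < rad L X := by linarith
  set S := pts L X with hS
  -- norms of the zeros
  have hcS : ∀ x ∈ S, ‖x‖ ≤ rad L X := by
    intro x hx
    obtain ⟨n, h1, h2, rfl⟩ := mem_pts L hx
    refine (norm_zpt_le L hX h1 h2).trans ?_
    have hX' : (0 : ℝ) ≤ X := by positivity
    unfold rad; nlinarith [one_le_r₁ L]
  -- orders of vanishing
  have hord : ∀ x ∈ S, (T' : ℕ∞) ≤ analyticOrderAt (G L c p) x := by
    intro x hx
    obtain ⟨n, h1, h2, rfl⟩ := mem_pts L hx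
    exact le_analyticOrderAt_G L c p (hF n h1 h2)
  -- the bound on the circle `|z| = 5 rad X`
  set θ : ℝ := ‖p‖ * ΘG L c C La L0 L1 X with hθ
  have h5 : 1 ≤ 5 * rad L X := by linarith
  have hθb : ∀ z ∈ sphere (0 : ℂ) (5 * rad L X), ‖G L c p z‖ ≤ θ := by
    intro z hz
    rw [mem_sphere_zero_iff_norm] at hz
    have := hG La L0 L1 p (5 * rad L X) h5 z hz.le
    rw [hθ, ΘG]
    calc ‖G L c p z‖ ≤ _ := this
      _ = _ := by ring
  have hmF : ∀ z ∈ sphere (0 : ℂ) (5 * rad L X),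
      (4 * rad L X) ^ (T' * S.card) ≤ ‖∏ x ∈ S, (z - x) ^ T'‖ := by
    intro z hz
    rw [mem_sphere_zero_iff_norm] at hz
    refine Baker1975.Analytic.le_norm_prod_pow S T' (by positivity) fun x hx => ?_
    calc 4 * rad L X = 5 * rad L X - rad L X := by ring
      _ ≤ ‖z‖ - ‖x‖ := by rw [hz]; linarith [hcS x hx]
      _ ≤ ‖z - x‖ := norm_sub_norm_le z x
  have hwF : ‖∏ x ∈ S, (w - x) ^ T'‖ ≤ (2 * rad L X) ^ (T' * S.card) :=
    Baker1975.Analytic.norm_prod_pow_le S T' fun x hx =>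
      calc ‖w - x‖ ≤ ‖w‖ + ‖x‖ := norm_sub_le w x
        _ ≤ 2 * rad L X := by linarith [hcS x hx]
  have hm0 : (0 : ℝ) < (4 * rad L X) ^ (T' * S.card) := by positivity
  have key := Baker1975.Analytic.norm_le_of_analyticOrderAt (differentiable_G L c p) S T' hord
    (R := 5 * rad L X) (by positivity) hθb hm0 hmF (w := w) (by linarith)
  have hθ0 : 0 ≤ θ := by rw [hθ]; exact mul_nonneg (norm_nonneg _) (ΘG_nonneg L c _ _ _ _)
  calc ‖G L c p w‖ ≤ θ / (4 * rad L X) ^ (T' * S.card) * ‖∏ x ∈ S, (w - x) ^ T'‖ := key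
    _ ≤ θ / (4 * rad L X) ^ (T' * S.card) * (2 * rad L X) ^ (T' * S.card) := by gcongr
    _ = θ * ((2 * rad L X) / (4 * rad L X)) ^ (T' * S.card) := by rw [div_pow]; field_simp
    _ = θ * (1 / 2) ^ (T' * X ^ 2) := by
        rw [hS, card_pts]
        congr 2
        field_simp
        ring

/-! ### Lower bound for `σ` at the translates `k + n₁ω₁ + n₂ω₂` -/

/-- `-(‖η‖(n‖z‖ + n²‖ω‖)) ≤ Re(η(nz + n²ω/2))`. [folklore] -/
lemma neg_le_re_exponent (η ω z : ℂ) (n : ℕ) :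
    -(‖η‖ * (n * ‖z‖ + (n : ℝ) ^ 2 * ‖ω‖)) ≤ (η * (n * z + n ^ 2 * ω / 2)).re := by
  have hre : |(η * (n * z + n ^ 2 * ω / 2)).re| ≤ ‖η‖ * ((n : ℝ) * ‖z‖ + (n : ℝ) ^ 2 * ‖ω‖) := by
    refine (Complex.abs_re_le_norm _).trans ?_
    rw [norm_mul]
    refine mul_le_mul_of_nonneg_left ((norm_add_le _ _).trans ?_) (norm_nonneg _)
    rw [norm_mul, Complex.norm_natCast, norm_div, norm_mul, norm_pow, Complex.norm_natCast,
      Complex.norm_two]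
    have : 0 ≤ (n : ℝ) ^ 2 * ‖ω‖ := by positivity
    linarith
  linarith [neg_abs_le ((η * (n * z + n ^ 2 * ω / 2)).re)]

/-- **Lower bound along 2-D translates**: for a compact set `K` avoiding the lattice there are
`c₀ ∈ (0, 1]` and `C₁ ≥ 0` with `‖σ(k + n₁ω₁ + n₂ω₂)‖ ≥ c₀ exp(-C₁ X²)` for all `k ∈ K` and
`n₁, n₂ ≤ 2X`, `X ≥ 1` (iterated quasi-periodicity in `ω₂` and then in `ω₁`, and
`min_K ‖σ‖ > 0`). [cite: Chudnovsky1984, Ch. 7 §3 p. 310] -/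
theorem le_norm_weierstrassSigma_add_lvec {K : Set ℂ} (hK : IsCompact K)
    (hKΛ : ∀ k ∈ K, k ∉ L.lattice) :
    ∃ c₀ : ℝ, 0 < c₀ ∧ c₀ ≤ 1 ∧ ∃ C₁ : ℝ, 0 ≤ C₁ ∧ ∀ k ∈ K, ∀ (X : ℕ), 1 ≤ X →
      ∀ n : ℕ × ℕ, n.1 ≤ 2 * X → n.2 ≤ 2 * X →
        c₀ * Real.exp (-(C₁ * (X : ℝ) ^ 2)) ≤ ‖L.weierstrassSigma (k + lvec L n)‖ := by
  rcases K.eq_empty_or_nonempty with rfl | hne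
  · exact ⟨1, one_pos, le_rfl, 0, le_rfl, fun k hk => (Set.notMem_empty k hk).elim⟩
  have hcont : ContinuousOn (fun z => ‖L.weierstrassSigma z‖) K :=
    L.differentiable_weierstrassSigma_holds.continuous.norm.continuousOn
  obtain ⟨k₀, hk₀, hmin⟩ := hK.exists_isMinOn hne hcont
  obtain ⟨ρ, hρ⟩ := hK.isBounded.exists_norm_le
  have hc0 : 0 < ‖L.weierstrassSigma k₀‖ :=
    norm_pos_iff.mpr (L.weierstrassSigma_ne_zero (hKΛ k₀ hk₀))
  set ρ' : ℝ := max ρ 0 with hρ'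
  set C₁ : ℝ := 4 * (‖L.η₁‖ + ‖L.η₂‖) * (ρ' + ‖L.ω₁‖ + ‖L.ω₂‖) with hC₁
  have hC₁0 : 0 ≤ C₁ := by positivity
  refine ⟨min ‖L.weierstrassSigma k₀‖ 1, by positivity, min_le_right _ _, C₁, hC₁0,
    fun k hk X hX n hn1 hn2 => ?_⟩
  have hX' : (1 : ℝ) ≤ X := by exact_mod_cast hX
  have hkρ : ‖k‖ ≤ ρ' := (hρ k hk).trans (le_max_left _ _)
  have hρ'0 : 0 ≤ ρ' := le_max_right _ _
  have hn1' : (n.1 : ℝ) ≤ 2 * X := by exact_mod_cast hn1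
  have hn2' : (n.2 : ℝ) ≤ 2 * X := by exact_mod_cast hn2
  -- step in `ω₂`
  have e2 := L.norm_weierstrassSigma_add_nat_mul L.weierstrassSigma_add_ω₂_holds n.2 k
  -- step in `ω₁`
  have e1 := L.norm_weierstrassSigma_add_nat_mul L.weierstrassSigma_add_ω₁_holds n.1
    (k + n.2 * L.ω₂)
  have hkl : k + lvec L n = k + n.2 * L.ω₂ + n.1 * L.ω₁ := by unfold lvec; ring
  rw [hkl, e1, e2]
  have hz2 : ‖k + (n.2 : ℂ) * L.ω₂‖ ≤ ρ' + 2 * X * ‖L.ω₂‖ := by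
    calc ‖k + (n.2 : ℂ) * L.ω₂‖ ≤ ‖k‖ + ‖(n.2 : ℂ) * L.ω₂‖ := norm_add_le _ _
      _ = ‖k‖ + n.2 * ‖L.ω₂‖ := by rw [norm_mul, Complex.norm_natCast]
      _ ≤ ρ' + 2 * X * ‖L.ω₂‖ := by gcongr
  have hE2 := neg_le_re_exponent L.η₂ L.ω₂ k n.2
  have hE1 := neg_le_re_exponent L.η₁ L.ω₁ (k + n.2 * L.ω₂) n.1
  -- the two exponents are `≥ -C₁ X² / 2` each
  have hXX : (X : ℝ) ≤ (X : ℝ) ^ 2 := by nlinarith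
  have hB2 : ‖L.η₂‖ * (n.2 * ‖k‖ + (n.2 : ℝ) ^ 2 * ‖L.ω₂‖) ≤
      4 * ‖L.η₂‖ * (ρ' + ‖L.ω₂‖) * (X : ℝ) ^ 2 := by
    have h1 : (n.2 : ℝ) * ‖k‖ ≤ 2 * X * ρ' := mul_le_mul hn2' hkρ (norm_nonneg _) (by positivity)
    have h2 : (n.2 : ℝ) ^ 2 * ‖L.ω₂‖ ≤ (2 * X) ^ 2 * ‖L.ω₂‖ :=
      mul_le_mul_of_nonneg_right (pow_le_pow_left₀ (Nat.cast_nonneg _) hn2' 2) (norm_nonneg _)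
    have h3 : (n.2 : ℝ) * ‖k‖ + (n.2 : ℝ) ^ 2 * ‖L.ω₂‖ ≤ 4 * (ρ' + ‖L.ω₂‖) * (X : ℝ) ^ 2 := by
      nlinarith [norm_nonneg L.ω₂]
    calc ‖L.η₂‖ * (n.2 * ‖k‖ + (n.2 : ℝ) ^ 2 * ‖L.ω₂‖) ≤ ‖L.η₂‖ * (4 * (ρ' + ‖L.ω₂‖) * (X : ℝ) ^ 2) :=
          mul_le_mul_of_nonneg_left h3 (norm_nonneg _)
      _ = _ := by ring
  have hB1 : ‖L.η₁‖ * (n.1 * ‖k + (n.2 : ℂ) * L.ω₂‖ + (n.1 : ℝ) ^ 2 * ‖L.ω₁‖) ≤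
      4 * ‖L.η₁‖ * (ρ' + ‖L.ω₁‖ + ‖L.ω₂‖) * (X : ℝ) ^ 2 := by
    have h1 : (n.1 : ℝ) * ‖k + (n.2 : ℂ) * L.ω₂‖ ≤ 2 * X * (ρ' + 2 * X * ‖L.ω₂‖) :=
      mul_le_mul hn1' hz2 (norm_nonneg _) (by positivity)
    have h2 : (n.1 : ℝ) ^ 2 * ‖L.ω₁‖ ≤ (2 * X) ^ 2 * ‖L.ω₁‖ :=
      mul_le_mul_of_nonneg_right (pow_le_pow_left₀ (Nat.cast_nonneg _) hn1' 2) (norm_nonneg _)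
    have h3 : (n.1 : ℝ) * ‖k + (n.2 : ℂ) * L.ω₂‖ + (n.1 : ℝ) ^ 2 * ‖L.ω₁‖ ≤
        4 * (ρ' + ‖L.ω₁‖ + ‖L.ω₂‖) * (X : ℝ) ^ 2 := by
      nlinarith [norm_nonneg L.ω₁, norm_nonneg L.ω₂]
    calc ‖L.η₁‖ * (n.1 * ‖k + (n.2 : ℂ) * L.ω₂‖ + (n.1 : ℝ) ^ 2 * ‖L.ω₁‖)
        ≤ ‖L.η₁‖ * (4 * (ρ' + ‖L.ω₁‖ + ‖L.ω₂‖) * (X : ℝ) ^ 2) :=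
          mul_le_mul_of_nonneg_left h3 (norm_nonneg _)
      _ = _ := by ring
  have hsum : -(C₁ * (X : ℝ) ^ 2) ≤ (L.η₁ * (n.1 * (k + n.2 * L.ω₂) + n.1 ^ 2 * L.ω₁ / 2)).re +
      (L.η₂ * (n.2 * k + n.2 ^ 2 * L.ω₂ / 2)).re := by
    have hC : C₁ * (X : ℝ) ^ 2 = 4 * ‖L.η₁‖ * (ρ' + ‖L.ω₁‖ + ‖L.ω₂‖) * (X : ℝ) ^ 2 +
        4 * ‖L.η₂‖ * (ρ' + ‖L.ω₁‖ + ‖L.ω₂‖) * (X : ℝ) ^ 2 := by rw [hC₁]; ring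
    have hB2' : ‖L.η₂‖ * (n.2 * ‖k‖ + (n.2 : ℝ) ^ 2 * ‖L.ω₂‖) ≤
        4 * ‖L.η₂‖ * (ρ' + ‖L.ω₁‖ + ‖L.ω₂‖) * (X : ℝ) ^ 2 := by
      refine hB2.trans ?_
      have : 0 ≤ 4 * ‖L.η₂‖ * ‖L.ω₁‖ * (X : ℝ) ^ 2 := by positivity
      nlinarith
    linarith
  have hσk : ‖L.weierstrassSigma k₀‖ ≤ ‖L.weierstrassSigma k‖ := isMinOn_iff.mp hmin k hk
  calc min ‖L.weierstrassSigma k₀‖ 1 * Real.exp (-(C₁ * (X : ℝ) ^ 2))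
      ≤ ‖L.weierstrassSigma k‖ * Real.exp ((L.η₁ * (n.1 * (k + n.2 * L.ω₂) + n.1 ^ 2 * L.ω₁ / 2)).re +
          (L.η₂ * (n.2 * k + n.2 ^ 2 * L.ω₂ / 2)).re) :=
        mul_le_mul ((min_le_left _ _).trans hσk) (Real.exp_le_exp.mpr hsum) (by positivity)
          (norm_nonneg _)
    _ = _ := by rw [Real.exp_add]; ring

/-! ### Division by `σ^{2(L₁-1)}` and Cauchy's inequality -/

/-- Off the lattice, `‖F_p(z)‖ = ‖G_p(z)‖ / ‖σ(z)‖^{2(L₁-1)}`. [folklore] -/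
theorem norm_F_eq {z : ℂ} (hz : z ∉ L.lattice) (p : Lam La L0 L1 → ℂ) :
    ‖F L c p z‖ = ‖G L c p z‖ / ‖L.weierstrassSigma z‖ ^ (2 * (L1 - 1)) := by
  have hσ := L.weierstrassSigma_ne_zero hz
  rw [G_eq L c hz p, norm_mul, norm_pow]
  field_simp

/-- Division step: a lower bound `c₀ e^{-B} ≤ ‖σ(z)‖` (`0 < c₀ ≤ 1`, `0 ≤ B`) turns
`‖G_p(z)‖ ≤ A` into `‖F_p(z)‖ ≤ A exp(2 L1 (log c₀⁻¹ + B))`. [folklore] -/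
theorem norm_F_le_of_sigma_lower {z : ℂ} (hz : z ∉ L.lattice) (p : Lam La L0 L1 → ℂ)
    {A c₀ B : ℝ} (hA : ‖G L c p z‖ ≤ A) (hA0 : 0 ≤ A) (hc₀ : 0 < c₀) (hc₁ : c₀ ≤ 1) (hB : 0 ≤ B)
    (hσ : c₀ * Real.exp (-B) ≤ ‖L.weierstrassSigma z‖) :
    ‖F L c p z‖ ≤ A * Real.exp (2 * L1 * (Real.log c₀⁻¹ + B)) := by
  rw [norm_F_eq L c hz p]
  set K : ℝ := Real.log c₀⁻¹ + B with hK
  have hlog : 0 ≤ Real.log c₀⁻¹ := Real.log_nonneg (one_le_inv₀ hc₀ |>.mpr hc₁)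
  have hK0 : 0 ≤ K := by positivity
  have hlow : 0 < c₀ * Real.exp (-B) := by positivity
  have hσpos : 0 < ‖L.weierstrassSigma z‖ := hlow.trans_le hσ
  have h1 : Real.exp (-K) ≤ ‖L.weierstrassSigma z‖ := by
    refine le_trans (le_of_eq ?_) hσ
    rw [hK, neg_add, Real.exp_add, Real.exp_neg, Real.exp_log (by positivity), inv_inv]
  set m : ℕ := 2 * (L1 - 1) with hm
  have hm2 : (m : ℝ) ≤ 2 * L1 := by
    have : m ≤ 2 * L1 := by omega
    exact_mod_cast this
  have h2 : Real.exp (-K) ^ m ≤ ‖L.weierstrassSigma z‖ ^ m := pow_le_pow_left₀ (by positivity) h1 m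
  have h3 : Real.exp (-(2 * L1 * K)) ≤ Real.exp (-K) ^ m := by
    rw [← Real.exp_nat_mul]
    exact Real.exp_le_exp.mpr (by nlinarith)
  rw [div_le_iff₀ (pow_pos hσpos _)]
  calc ‖G L c p z‖ ≤ A := hA
    _ = A * Real.exp (2 * L1 * K) * Real.exp (-(2 * L1 * K)) := by
        rw [mul_assoc, ← Real.exp_add, add_neg_cancel, Real.exp_zero, mul_one]
    _ ≤ A * Real.exp (2 * L1 * K) * ‖L.weierstrassSigma z‖ ^ m := by
        gcongr
        exact h3.trans h2

/-- A closed disc around `ω₁/2` missing the lattice, of radius `≤ 1/2`. [folklore] -/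
theorem exists_closedBall_subset_compl_lattice_half :
    ∃ δ : ℝ, 0 < δ ∧ δ ≤ 1 / 2 ∧ closedBall (L.ω₁ / 2) δ ⊆ (L.lattice : Set ℂ)ᶜ := by
  obtain ⟨δ, hδ, hδ1, hball⟩ := exists_closedBall_subset_compl_lattice L
  exact ⟨min δ (1 / 2), by positivity, min_le_right _ _,
    (closedBall_subset_closedBall (min_le_left _ _)).trans hball⟩

/-- `exp(a) (1/2)^m exp(b) = exp(a+b) (1/2)^m`. [folklore] -/
lemma exp_mul_half_pow_mul_exp (a b : ℝ) (m : ℕ) :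
    Real.exp a * (1 / 2 : ℝ) ^ m * Real.exp b = Real.exp (a + b) * (1 / 2 : ℝ) ^ m := by
  rw [Real.exp_add]; ring

/-- The constant `A₁ = 5(2r₁ + 1) + ‖ω₁‖`: `5 rad X + ‖ω₁‖ ≤ A₁ X`. [folklore] -/
def A₁ : ℝ := 5 * (2 * r₁ L + 1) + ‖L.ω₁‖

/-- `1 ≤ A₁`. [folklore] -/
lemma one_le_A₁ : 1 ≤ A₁ L := by
  unfold A₁; nlinarith [one_le_r₁ L, norm_nonneg L.ω₁]

/-- `5 rad X + ‖ω₁‖ ≤ A₁ X` for `X ≥ 1`. [folklore] -/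
lemma five_rad_add_le {X : ℕ} (hX : 1 ≤ X) : 5 * rad L X + ‖L.ω₁‖ ≤ A₁ L * X := by
  have hX' : (1 : ℝ) ≤ X := by exact_mod_cast hX
  have h1 : A₁ L * X = 5 * rad L X + ‖L.ω₁‖ * X := by unfold A₁ rad; ring
  have h2 : ‖L.ω₁‖ ≤ ‖L.ω₁‖ * X := le_mul_of_one_le_right (norm_nonneg _) hX'
  linarith

/-- The exponent constant `K_Θ(C) = A₁ + ‖c‖A₁ + C(1 + 25(2r₁+1)²)` of the bound for `ΘG`.
[folklore] -/
def KΘ (C : ℝ) : ℝ := A₁ L + ‖c‖ * A₁ L + C * (1 + 25 * (2 * r₁ L + 1) ^ 2)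

/-- `0 ≤ K_Θ(C)` for `C ≥ 0`. [folklore] -/
lemma KΘ_nonneg {C : ℝ} (hC : 0 ≤ C) : 0 ≤ KΘ L c C := by
  unfold KΘ
  have := one_le_A₁ L
  positivity

/-- `ΘG(X) ≤ #Λ · exp(K_Θ (La X + L0 X + L1 X²))` (`X ≥ 1`, `C ≥ 0`). [folklore] -/
lemma ΘG_le {C : ℝ} (hC : 0 ≤ C) (La L0 L1 : ℕ) {X : ℕ} (hX : 1 ≤ X) :
    ΘG L c C La L0 L1 X ≤
      Fintype.card (Lam La L0 L1) * Real.exp (KΘ L c C * (La * X + L0 * X + L1 * X ^ 2)) := by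
  have hX' : (1 : ℝ) ≤ X := by exact_mod_cast hX
  have h5rad := five_rad_add_le L hX
  have hA₁ := one_le_A₁ L
  have hr1 := one_le_r₁ L
  have hpos : 0 < 5 * rad L X + ‖L.ω₁‖ := by
    have := one_le_rad L hX; linarith [norm_nonneg L.ω₁]
  set P1 : ℝ := La * X with hP1
  set P2 : ℝ := L0 * X with hP2
  set P3 : ℝ := L1 * X ^ 2 with hP3
  have p1 : 0 ≤ P1 := by positivity
  have p2 : 0 ≤ P2 := by positivity
  have p3 : 0 ≤ P3 := by positivity
  set Q1 : ℝ := A₁ L with hQ1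
  set Q2 : ℝ := ‖c‖ * A₁ L with hQ2
  set Q3 : ℝ := C * (1 + 25 * (2 * r₁ L + 1) ^ 2) with hQ3
  have q1 : 0 ≤ Q1 := by positivity
  have q2 : 0 ≤ Q2 := by positivity
  have q3 : 0 ≤ Q3 := by positivity
  have e1 : (5 * rad L X + ‖L.ω₁‖) ^ La ≤ Real.exp (Q1 * P1) := by
    calc (5 * rad L X + ‖L.ω₁‖) ^ La ≤ (A₁ L * X) ^ La := pow_le_pow_left₀ hpos.le h5rad _
      _ ≤ Real.exp (A₁ L * X) ^ La := by
          refine pow_le_pow_left₀ (by positivity) ?_ _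
          linarith [Real.add_one_le_exp (A₁ L * X)]
      _ = Real.exp (Q1 * P1) := by rw [← Real.exp_nat_mul, hQ1, hP1]; ring_nf
  have e2 : Real.exp (L0 * ‖c‖ * (5 * rad L X + ‖L.ω₁‖)) ≤ Real.exp (Q2 * P2) := by
    refine Real.exp_le_exp.mpr ?_
    have h0 : (0 : ℝ) ≤ L0 * ‖c‖ := by positivity
    calc (L0 : ℝ) * ‖c‖ * (5 * rad L X + ‖L.ω₁‖) ≤ L0 * ‖c‖ * (A₁ L * X) :=
          mul_le_mul_of_nonneg_left h5rad h0
      _ = Q2 * P2 := by rw [hQ2, hP2]; ring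
  have e3 : Real.exp (C * L1 * (1 + (5 * rad L X) ^ 2)) ≤ Real.exp (Q3 * P3) := by
    refine Real.exp_le_exp.mpr ?_
    have h1 : 1 + (5 * rad L X) ^ 2 ≤ (1 + 25 * (2 * r₁ L + 1) ^ 2) * (X : ℝ) ^ 2 := by
      unfold rad; nlinarith
    have h0 : (0 : ℝ) ≤ C * L1 := by positivity
    calc C * L1 * (1 + (5 * rad L X) ^ 2) ≤ C * L1 * ((1 + 25 * (2 * r₁ L + 1) ^ 2) * (X : ℝ) ^ 2) :=
          mul_le_mul_of_nonneg_left h1 h0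
      _ = Q3 * P3 := by rw [hQ3, hP3]; ring
  have hcross : Q1 * P1 + Q2 * P2 + Q3 * P3 ≤ (Q1 + Q2 + Q3) * (P1 + P2 + P3) := by
    have hx : (Q1 + Q2 + Q3) * (P1 + P2 + P3) - (Q1 * P1 + Q2 * P2 + Q3 * P3) =
        Q1 * P2 + Q1 * P3 + Q2 * P1 + Q2 * P3 + Q3 * P1 + Q3 * P2 := by ring
    nlinarith [mul_nonneg q1 p2, mul_nonneg q1 p3, mul_nonneg q2 p1, mul_nonneg q2 p3,
      mul_nonneg q3 p1, mul_nonneg q3 p2]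
  have hK : KΘ L c C = Q1 + Q2 + Q3 := by rw [hQ1, hQ2, hQ3]; rfl
  unfold ΘG
  calc (Fintype.card (Lam La L0 L1) : ℝ) * (5 * rad L X + ‖L.ω₁‖) ^ La *
        Real.exp (L0 * ‖c‖ * (5 * rad L X + ‖L.ω₁‖)) * Real.exp (C * L1 * (1 + (5 * rad L X) ^ 2))
      ≤ Fintype.card (Lam La L0 L1) * Real.exp (Q1 * P1) * Real.exp (Q2 * P2) * Real.exp (Q3 * P3) := by
        gcongr
    _ = Fintype.card (Lam La L0 L1) * Real.exp (Q1 * P1 + Q2 * P2 + Q3 * P3) := by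
        rw [Real.exp_add, Real.exp_add]; ring
    _ ≤ Fintype.card (Lam La L0 L1) * Real.exp (KΘ L c C * (P1 + P2 + P3)) := by
        rw [hK]; gcongr

/-- **The fundamental upper bound** (Chudnovsky 1984, Ch. 7, (2.5) p. 306 and p. 310): there is
a constant `C_F ≥ 0` depending only on the lattice and `c` such that, if `F_p^{(t)}(z_n) = 0` for
all `t < T'` and all `n ∈ [0, X)²` (`X ≥ 1`), then for every `n ∈ [0, 2X)²` and every `t`,
`|F_p^{(t)}(z_n)| ≤ ‖p‖ · #Λ · t! · exp(C_F (t + La X + L0 X + L1 X²)) · (1/2)^{T' X²}`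
(Schwarz's lemma for `G_p`, division by `σ^{2(L₁-1)}` on a small circle around `z_n`, Cauchy's
inequality). [cite: Chudnovsky1984, Ch. 7 Thm 4.1 p. 318] -/
theorem norm_iteratedDeriv_F_zpt_le_of_zeros :
    ∃ C_F : ℝ, 0 ≤ C_F ∧ ∀ (La L0 L1 X T' : ℕ), 1 ≤ X → ∀ p : Lam La L0 L1 → ℂ,
      (∀ n : ℕ × ℕ, n.1 < X → n.2 < X → ∀ t < T', iteratedDeriv t (F L c p) (zpt L n) = 0) →
      ∀ n : ℕ × ℕ, n.1 < 2 * X → n.2 < 2 * X → ∀ t : ℕ,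
        ‖iteratedDeriv t (F L c p) (zpt L n)‖ ≤
          ‖p‖ * Fintype.card (Lam La L0 L1) * t ! *
            Real.exp (C_F * (t + La * X + L0 * X + L1 * X ^ 2)) * (1 / 2) ^ (T' * X ^ 2) := by
  obtain ⟨δ, hδ, hδ1, hball⟩ := exists_closedBall_subset_compl_lattice_half L
  obtain ⟨CG, hCG, hG⟩ := norm_G_le L c
  have hKc : IsCompact (sphere (L.ω₁ / 2) δ) := isCompact_sphere _ _
  have hKΛ : ∀ k ∈ sphere (L.ω₁ / 2) δ, k ∉ L.lattice := fun k hk => hball (sphere_subset_closedBall hk)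
  obtain ⟨c₀, hc₀, hc₀1, C₁, hC₁, hlow⟩ := le_norm_weierstrassSigma_add_lvec L hKc hKΛ
  have hlog : 0 ≤ Real.log c₀⁻¹ := Real.log_nonneg (one_le_inv₀ hc₀ |>.mpr hc₀1)
  have hlogδ : 0 ≤ Real.log δ⁻¹ := Real.log_nonneg (one_le_inv₀ hδ |>.mpr (by linarith))
  -- the constants
  set K₁ : ℝ := KΘ L c CG with hK₁
  have hK₁0 : 0 ≤ K₁ := KΘ_nonneg L c hCG
  set K₂ : ℝ := 2 * (Real.log c₀⁻¹ + C₁) with hK₂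
  have hK₂0 : 0 ≤ K₂ := by positivity
  set C_F : ℝ := Real.log δ⁻¹ + (K₁ + K₂) with hCF
  have hCF0 : 0 ≤ C_F := by positivity
  refine ⟨C_F, hCF0, fun La L0 L1 X T' hX p hF n hn1 hn2 t => ?_⟩
  have hX' : (1 : ℝ) ≤ X := by exact_mod_cast hX
  have hrad1 := one_le_rad L hX
  -- Schwarz on `|w| ≤ rad X`
  set A : ℝ := ‖p‖ * ΘG L c CG La L0 L1 X * (1 / 2) ^ (T' * X ^ 2) with hAdef
  have hA0 : 0 ≤ A := by
    rw [hAdef]; exact mul_nonneg (mul_nonneg (norm_nonneg _) (ΘG_nonneg L c _ _ _ _)) (by positivity)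
  set B : ℝ := A * Real.exp (2 * L1 * (Real.log c₀⁻¹ + C₁ * (X : ℝ) ^ 2)) with hBdef
  have hB0 : 0 ≤ B := by positivity
  have hsphere : ∀ w ∈ sphere (zpt L n) δ, ‖F L c p w‖ ≤ B := by
    intro w hw
    have hk : w - lvec L n ∈ sphere (L.ω₁ / 2) δ := by
      rw [mem_sphere_iff_norm] at hw ⊢
      rw [← hw]; congr 1; unfold zpt; ring
    have hwΛ : w ∉ L.lattice := by
      intro h
      exact hKΛ _ hk (by simpa using sub_mem h (lvec_mem L n))
    have hσ : c₀ * Real.exp (-(C₁ * (X : ℝ) ^ 2)) ≤ ‖L.weierstrassSigma w‖ := by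
      have := hlow _ hk X hX n hn1.le hn2.le
      rwa [sub_add_cancel] at this
    have hwn : ‖w‖ ≤ rad L X := by
      have h2X : 1 ≤ 2 * X := by omega
      have := norm_zpt_add_le L h2X hn1 hn2 (u := w - zpt L n)
        (by rw [mem_sphere_iff_norm] at hw; rw [hw]; exact hδ1)
      have h' : zpt L n + (w - zpt L n) = w := by ring
      rw [h'] at this
      refine this.trans ?_
      unfold rad; push_cast; nlinarith [one_le_r₁ L]
    have hGw : ‖G L c p w‖ ≤ A := norm_G_le_of_zeros L c hG hX p hF hwn
    exact norm_F_le_of_sigma_lower L c hwΛ p hGw hA0 hc₀ hc₀1 (by positivity) hσ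
  -- Cauchy's inequality
  have hdiff : DiffContOnCl ℂ (F L c p) (ball (zpt L n) δ) := by
    refine DifferentiableOn.diffContOnCl fun w hw => ?_
    have hw' : w ∈ closedBall (zpt L n) δ := closure_ball_subset_closedBall hw
    have hk : w - lvec L n ∈ closedBall (L.ω₁ / 2) δ := by
      rw [mem_closedBall_iff_norm] at hw' ⊢
      refine le_trans (le_of_eq ?_) hw'
      congr 1; unfold zpt; ring
    have hwΛ : w ∉ L.lattice := by
      intro h
      exact hball hk (by simpa using sub_mem h (lvec_mem L n))
    exact (analyticAt_F L c p hwΛ).differentiableAt.differentiableWithinAt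
  have hC := Complex.norm_iteratedDeriv_le_of_forall_mem_sphere_norm_le t hδ hdiff hsphere
  -- bookkeeping
  set Φ : ℝ := (La : ℝ) * X + L0 * X + L1 * X ^ 2 with hΦ
  have hΦ0 : 0 ≤ Φ := by positivity
  have hL1Φ : (L1 : ℝ) * X ^ 2 ≤ Φ := by
    rw [hΦ]
    have : (0 : ℝ) ≤ La * X + L0 * X := by positivity
    linarith
  have hδt : (δ ^ t)⁻¹ ≤ Real.exp (Real.log δ⁻¹ * t) := by
    rw [mul_comm, Real.exp_nat_mul, Real.exp_log (inv_pos.mpr hδ), inv_pow]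
  have hΘ : ΘG L c CG La L0 L1 X ≤ Fintype.card (Lam La L0 L1) * Real.exp (K₁ * Φ) :=
    ΘG_le L c hCG La L0 L1 hX
  have hexp2 : Real.exp (2 * L1 * (Real.log c₀⁻¹ + C₁ * (X : ℝ) ^ 2)) ≤ Real.exp (K₂ * Φ) := by
    refine Real.exp_le_exp.mpr ?_
    have hX2 : (1 : ℝ) ≤ (X : ℝ) ^ 2 := by nlinarith
    have h0 : (0 : ℝ) ≤ L1 := Nat.cast_nonneg _
    have hdiff : K₂ * (L1 * (X : ℝ) ^ 2) - 2 * L1 * (Real.log c₀⁻¹ + C₁ * (X : ℝ) ^ 2) =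
        2 * L1 * Real.log c₀⁻¹ * ((X : ℝ) ^ 2 - 1) := by rw [hK₂]; ring
    have hnn : 0 ≤ 2 * L1 * Real.log c₀⁻¹ * ((X : ℝ) ^ 2 - 1) :=
      mul_nonneg (by positivity) (sub_nonneg.mpr hX2)
    have hmono : K₂ * (L1 * (X : ℝ) ^ 2) ≤ K₂ * Φ := mul_le_mul_of_nonneg_left hL1Φ hK₂0
    linarith
  have hB : B ≤ ‖p‖ * Fintype.card (Lam La L0 L1) * Real.exp ((K₁ + K₂) * Φ) * (1 / 2) ^ (T' * X ^ 2) := by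
    calc B = ‖p‖ * ΘG L c CG La L0 L1 X * (1 / 2) ^ (T' * X ^ 2) *
          Real.exp (2 * L1 * (Real.log c₀⁻¹ + C₁ * (X : ℝ) ^ 2)) := by rw [hBdef, hAdef]
      _ ≤ ‖p‖ * (Fintype.card (Lam La L0 L1) * Real.exp (K₁ * Φ)) * (1 / 2) ^ (T' * X ^ 2) *
          Real.exp (K₂ * Φ) := by gcongr
      _ = _ := by rw [add_mul, Real.exp_add]; ring
  have hfinal : (K₁ + K₂) * Φ + Real.log δ⁻¹ * t ≤ C_F * (t + Φ) := by
    have ht0 : (0 : ℝ) ≤ t := Nat.cast_nonneg _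
    rw [hCF]
    nlinarith [mul_nonneg hlogδ hΦ0, mul_nonneg (add_nonneg hK₁0 hK₂0) ht0]
  calc ‖iteratedDeriv t (F L c p) (zpt L n)‖ ≤ t ! * B / δ ^ t := hC
    _ = t ! * B * (δ ^ t)⁻¹ := by rw [div_eq_mul_inv]
    _ ≤ t ! * (‖p‖ * Fintype.card (Lam La L0 L1) * Real.exp ((K₁ + K₂) * Φ) * (1 / 2) ^ (T' * X ^ 2)) *
        Real.exp (Real.log δ⁻¹ * t) := by gcongr
    _ = ‖p‖ * Fintype.card (Lam La L0 L1) * t ! * Real.exp ((K₁ + K₂) * Φ + Real.log δ⁻¹ * t) *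
        (1 / 2) ^ (T' * X ^ 2) := by
        rw [Real.exp_add]; ring
    _ ≤ ‖p‖ * Fintype.card (Lam La L0 L1) * t ! * Real.exp (C_F * (t + Φ)) * (1 / 2) ^ (T' * X ^ 2) := by
        gcongr
    _ = _ := by rw [hΦ]; ring_nf

end Literature.NumberTheory.Transcendental.TubbsPeriods

end
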